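import Summits.NavierStokesRegularity.FluidComputer.PeriodicProfileClockRigidity
import Literature.Analysis.FluidPDE.SuitableWeak
import HarnessLib

/-!
# An exactly discretely self-similar object in an arbitrary clock: DSS at EVERY physical time of a
# terminal interval, and a genuinely SINGULAR blow-up point (local DSS Liouville by scaling)

Summit `NavierStokesRegularity`, cell topic directory `FluidComputer`, namespace
`…FluidComputer.SelfSimilarCensus`; zone Z7 of the D-0081 profile search («generalised self-similar
with logarithmic correction (DSS / log-periodic ansatz)»). Sequel to `PeriodicProfileClockRigidity.lean`
(a `P`-periodic profile `W(σ, ·)` in an ARBITRARY clock `(ℓ, θ)`, `θ′ = ℓ⁻²`, solving the momentum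
equation at the clock times, blows up only as a BACKWARD parabolic DSS object:
`u(T − (T − θ(σ))/c², x) = c • u(θ(σ), c • x)`, `c > 1`, `0 < m ≤ (T − θ)ℓ² ≤ M`). That file speaks
at the clock times `θ(σ)` only and keeps `σ` primary; here the same statements are transported to
PHYSICAL time and turned into the first print a census row asks of a blow-up candidate — is the
blow-up point singular. (The second print, the RATE — Type I, never Type II — and the
`IsRegularPoint` / `IsSingularTime` vocabulary are the companion `PeriodicProfileTypeIRate.lean`.)
PROVED theorems only; no definitions, no named facts.

## Content

* §1 `exists_clockTime_eq` — the clock's physical-time range covers a TERMINAL INTERVAL: every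
  `t ∈ (θ(σ₁), T)` is a clock time `θ(σ)`, `σ > σ₁` (intermediate value theorem; no inverse clock is
  introduced).
* §2 `eq_zero_of_dss_Ioo_of_norm_le` — LOCAL DSS LIOUVILLE BY PURE SCALING: a field on ANY normed
  space with the backward parabolic DSS covariance `u(T − (T − t)/c², x) = c • u(t, c • x)` for the
  times `t` of a terminal interval `(T₁, T)` ONLY (`c > 1`), bounded on ONE backward parabolic
  cylinder `parabolicCylinder ρ (T, 0)`, vanishes identically on `(T₁, T) × E`. This is Chae–Wolf
  2017, §3 step 1 (`|u(x,t)| = λ⁻ᵏ|u(λ⁻ᵏx, λ⁻²ᵏt)| ≤ Cλ⁻ᵏ → 0`), localised at the blow-up point: the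
  tree's `Literature.Analysis.FluidPDE.IsDiscretelySelfSimilar.eq_zero_of_norm_le_parabolicCylinder`
  is the same line for the GLOBAL relation `nsRescale c u = u` (all `t ∈ ℝ`); an exact ansatz on a
  terminal interval never supplies the global relation, whence this version.
* §3 under the standing hypotheses of `PeriodicProfileClockRigidity` §4 (open half-line `σ > σ₀`,
  `ℓ > 0`, `P > 0`, `W` jointly `C¹` and `P`-periodic with every slice `W(σ, ·) ≢ 0`, ansatz +
  pressure ansatz + momentum equation at the clock times, ANY `ν`, ANY finite-dimensional `E`) and
  bounded physical time `θ → T`: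
  `periodicProfile_dss_Ioo` (the covariance at EVERY `t ∈ (θ(σ₁), T)`, `σ₁ > σ₀`),
  `periodicProfile_nsRescale_eq_Ioo` (`T = 0`: `nsRescale c u t = u t` for every `t ∈ (θ(σ₁), 0)`,
  `σ₁ > σ₀ + P` — the tree's `IsDiscretelySelfSimilar` relation on a terminal time interval),
  `periodicProfile_eq_zero_of_norm_le` / **`periodicProfile_unbounded_near_blowupPoint`** (the object
  is UNBOUNDED on every backward parabolic cylinder at `(T, 0)`: the blow-up point is genuinely
  singular — a bounded one would make a whole slice `W(σ, ·)` vanish).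

READING for the Z7 row (lead's pen): an EXACT DSS object in ANY clock is discretely self-similar at
every physical time near `T` and has a genuinely singular blow-up point at the centre of the
collapse; a «regular» DSS candidate (bounded near `(T, 0)`) is the zero profile.

WHAT THIS IS NOT: not an existence or non-existence claim for DSS profiles, not a statement about
which branch a Navier–Stokes evolution takes, not Navier–Stokes evidence; the momentum equation and
the ansatz are asked only at the clock times (as in every printed DSS ansatz); `violates:` none — no
object. Tree search: `lean search 'eq_zero_of_norm_le_parabolicCylinder|parabolicCylinder'` — the
global-DSS scaling lemma (`VorticityDoubleConeSelfSimilar`), the CKN cylinders (`SuitableWeak`), the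
Scheffer/Ożański NSI glue (`not_isRegularPoint_glue`); nothing for a DSS relation on a terminal
interval or for a periodic profile in a general clock.

## References (context; the statements are folklore consequences of the scaling symmetry)

* D. Chae, J. Wolf, Arch. Rational Mech. Anal. 225 (2017), §3 step 1 (arXiv:1610.09464 p. 8).
  [ChaeWolf2017RemovingDSS]
* J. Leray, Acta Math. 63 (1934), §20. [Leray1934]
-/

noncomputable section

open Set Filter Topology InnerProductSpace Function Metric
open scoped Laplacian RealInnerProductSpace

namespace Summit.NavierStokesRegularity.FluidComputer.SelfSimilarCensus

open Literature.Analysis.FluidPDE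

/-! ### §1 The clock's physical-time range covers a terminal interval -/

section ClockRange

variable {ℓ θ : ℝ → ℝ} {σ₁ T t : ℝ}

/-- **Every physical time of a terminal interval is a clock time.** If `θ` is differentiable on
`σ ≥ σ₁` (here with the clock derivative `θ′ = ℓ⁻²`, but only continuity is used) and `θ(σ) → T`
as `σ → ∞`, then every `t` with `θ(σ₁) < t < T` is `θ(σ)` for some `σ > σ₁` (intermediate value
theorem on `[σ₁, σ₂]` with `θ(σ₂) > t`). No inverse clock is introduced. [folklore] -/
theorem exists_clockTime_eq (hθ : ∀ σ, σ₁ ≤ σ → HasDerivAt θ ((ℓ σ ^ 2)⁻¹) σ)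
    (hT : Tendsto θ atTop (𝓝 T)) (h1 : θ σ₁ < t) (h2 : t < T) : ∃ σ, σ₁ < σ ∧ θ σ = t := by
  -- a later similarity time whose physical time exceeds `t`
  obtain ⟨σ₂, hσ₂, hθ₂⟩ : ∃ σ₂, σ₁ ≤ σ₂ ∧ t < θ σ₂ := by
    have hev : ∀ᶠ s in atTop, σ₁ ≤ s ∧ t < θ s :=
      (eventually_ge_atTop σ₁).and (hT.eventually (lt_mem_nhds h2))
    exact hev.exists
  have hcont : ContinuousOn θ (Icc σ₁ σ₂) :=
    fun s hs => ((hθ s hs.1).continuousAt).continuousWithinAt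
  obtain ⟨σ, hσ, hσt⟩ := intermediate_value_Icc hσ₂ hcont ⟨h1.le, hθ₂.le⟩
  refine ⟨σ, lt_of_le_of_ne hσ.1 ?_, hσt⟩
  rintro rfl
  exact h1.ne hσt

end ClockRange

/-! ### §2 Local DSS Liouville by pure scaling (Chae–Wolf 2017, §3 step 1, at the blow-up point) -/

section LocalLiouville

variable {E : Type*} [NormedAddCommGroup E] [NormedSpace ℝ E]
variable {F : Type*} [NormedAddCommGroup F] [NormedSpace ℝ F]
variable {u : ℝ → E → F} {c T T₁ : ℝ}

/-- **Iterated covariance.** If `u(T − (T − t)/c², x) = c • u(t, c • x)` for every time `t` of the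
terminal interval `(T₁, T)` (`c > 1`), then for every such `t`, every `y` and every `k : ℕ`,
`u(t, y) = (cᵏ)⁻¹ • u(T − (T − t)/(c²)ᵏ, (cᵏ)⁻¹ • y)`: the value at `(t, y)` is read off, with the
factor `c⁻ᵏ`, at a point `k` periods closer to the blow-up point `(T, 0)`. [folklore] -/
theorem dss_Ioo_iterate (hc : 1 < c)
    (hdss : ∀ t ∈ Ioo T₁ T, ∀ x : E, u (T - (T - t) / c ^ 2) x = c • u t (c • x))
    (k : ℕ) : ∀ t ∈ Ioo T₁ T, ∀ y : E,
      u t y = (c ^ k)⁻¹ • u (T - (T - t) / (c ^ 2) ^ k) ((c ^ k)⁻¹ • y) := by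
  have hc0 : 0 < c := zero_lt_one.trans hc
  have hc2 : 1 < c ^ 2 := by nlinarith
  induction k with
  | zero =>
    intro t _ y
    simp
  | succ k ih =>
    intro t ht y
    -- one step: `u(t, y) = c⁻¹ • u(t', c⁻¹ • y)`, `t' = T − (T − t)/c²`, and `t' ∈ (T₁, T)`
    have ht' : T - (T - t) / c ^ 2 ∈ Ioo T₁ T := by
      have hTt : 0 < T - t := sub_pos.2 ht.2
      refine ⟨?_, by have := div_pos hTt (zero_lt_one.trans hc2); linarith⟩
      have h1 : (T - t) / c ^ 2 < T - t := div_lt_self hTt hc2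
      linarith [ht.1]
    have hstep : u t y = c⁻¹ • u (T - (T - t) / c ^ 2) (c⁻¹ • y) := by
      have h := hdss t ht (c⁻¹ • y)
      rw [smul_smul, mul_inv_cancel₀ hc0.ne', one_smul] at h
      rw [h, smul_smul, inv_mul_cancel₀ hc0.ne', one_smul]
    rw [hstep, ih _ ht' (c⁻¹ • y), smul_smul, smul_smul]
    have e2 : T - (T - (T - (T - t) / c ^ 2)) / (c ^ 2) ^ k = T - (T - t) / (c ^ 2) ^ (k + 1) := by
      rw [pow_succ]
      field_simp
      ring
    have e3 : (c ^ k)⁻¹ * c⁻¹ = (c ^ (k + 1))⁻¹ := by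
      rw [pow_succ, mul_inv]
    have e4 : c⁻¹ * (c ^ k)⁻¹ = (c ^ (k + 1))⁻¹ := by
      rw [pow_succ, mul_inv, mul_comm]
    rw [e2, e3, e4]

/-- **LOCAL DSS LIOUVILLE BY PURE SCALING.** Let `u : ℝ → E → F` (any normed spaces) satisfy the
backward parabolic DSS covariance `u(T − (T − t)/c², x) = c • u(t, c • x)` for every time `t` of a
terminal interval `(T₁, T)` and every `x`, with `c > 1`, and let `‖u‖ ≤ B` on one backward
parabolic cylinder `parabolicCylinder ρ (T, 0) = (T − ρ², T) × B_ρ(0)`, `ρ > 0`. Then `u(t, x) = 0`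
for every `t ∈ (T₁, T)` and every `x`: by `dss_Ioo_iterate`, `‖u(t, x)‖ = c⁻ᵏ‖u(t_k, c⁻ᵏx)‖` with
`t_k = T − (T − t)/c²ᵏ ↑ T`, `c⁻ᵏx → 0`, so `(t_k, c⁻ᵏx)` enters the cylinder and `‖u(t, x)‖ ≤ Bc⁻ᵏ → 0`.
Chae–Wolf 2017, §3 step 1, localised: only the covariance on `(T₁, T)` is used (the tree's
`IsDiscretelySelfSimilar.eq_zero_of_norm_le_parabolicCylinder` assumes the global relation).
[cite: ChaeWolf2017RemovingDSS, §3 step 1 (arXiv:1610.09464 p. 8)] -/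
theorem eq_zero_of_dss_Ioo_of_norm_le (hc : 1 < c)
    (hdss : ∀ t ∈ Ioo T₁ T, ∀ x : E, u (T - (T - t) / c ^ 2) x = c • u t (c • x))
    {ρ B : ℝ} (hρ : 0 < ρ)
    (hB : ∀ z ∈ parabolicCylinder ρ ((T, 0) : ℝ × E), ‖u z.1 z.2‖ ≤ B) :
    ∀ t ∈ Ioo T₁ T, ∀ x : E, u t x = 0 := by
  intro t ht x
  have hc0 : 0 < c := zero_lt_one.trans hc
  have hc2 : 1 < c ^ 2 := by nlinarith
  have hTt : 0 < T - t := sub_pos.2 ht.2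
  -- the iterates enter the cylinder: `(T − t)/(c²)ᵏ < ρ²` and `‖x‖/cᵏ < ρ` eventually
  have hgrow2 : Tendsto (fun k : ℕ => (c ^ 2) ^ k) atTop atTop := tendsto_pow_atTop_atTop_of_one_lt hc2
  have hgrow : Tendsto (fun k : ℕ => c ^ k) atTop atTop := tendsto_pow_atTop_atTop_of_one_lt hc
  have hev : ∀ᶠ k : ℕ in atTop, ‖u t x‖ ≤ B / c ^ k := by
    filter_upwards [hgrow2.eventually_gt_atTop ((T - t) / ρ ^ 2), hgrow.eventually_gt_atTop (‖x‖ / ρ)]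
      with k hk1 hk2
    have hck : 0 < c ^ k := pow_pos hc0 k
    have hc2k : 0 < (c ^ 2) ^ k := pow_pos (pow_pos hc0 2) k
    have hmem : ((T - (T - t) / (c ^ 2) ^ k, (c ^ k)⁻¹ • x) : ℝ × E) ∈
        parabolicCylinder ρ ((T, 0) : ℝ × E) := by
      rw [mem_parabolicCylinder]
      refine ⟨⟨?_, ?_⟩, ?_⟩
      · have h1 : (T - t) / (c ^ 2) ^ k < ρ ^ 2 := by
          rw [div_lt_iff₀ hc2k]
          have := (div_lt_iff₀ (pow_pos hρ 2)).1 hk1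
          linarith
        show T - ρ ^ 2 < T - (T - t) / (c ^ 2) ^ k
        linarith
      · show T - (T - t) / (c ^ 2) ^ k < T
        linarith [div_pos hTt hc2k]
      · show dist ((c ^ k)⁻¹ • x) 0 < ρ
        rw [dist_zero_right, norm_smul, norm_inv, Real.norm_of_nonneg hck.le, inv_mul_lt_iff₀ hck]
        have := (div_lt_iff₀ hρ).1 hk2
        linarith
    have hval := dss_Ioo_iterate hc hdss k t ht x
    rw [hval, norm_smul, norm_inv, Real.norm_of_nonneg hck.le]
    calc (c ^ k)⁻¹ * ‖u (T - (T - t) / (c ^ 2) ^ k) ((c ^ k)⁻¹ • x)‖ ≤ (c ^ k)⁻¹ * B :=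
        mul_le_mul_of_nonneg_left (hB _ hmem) (inv_nonneg.2 hck.le)
      _ = B / c ^ k := by rw [div_eq_inv_mul]
  have hlim : Tendsto (fun k : ℕ => B / c ^ k) atTop (𝓝 0) := tendsto_const_nhds.div_atTop hgrow
  exact norm_le_zero_iff.1 (ge_of_tendsto hlim hev)

end LocalLiouville

/-! ### §3 The periodic-profile object: DSS at every physical time, and a singular blow-up point -/

section PeriodicProfile

variable {E : Type*} [NormedAddCommGroup E] [InnerProductSpace ℝ E] [FiniteDimensional ℝ E]
variable {W : ℝ → E → E} {Q : ℝ → E → ℝ} {u : ℝ → E → E} {p : ℝ → E → ℝ}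
  {ℓ ℓ' θ : ℝ → ℝ} {ν P σ₀ T : ℝ}

/-! Standing hypotheses of §3 = those of `PeriodicProfileClockRigidity` §4, verbatim: on the open
half-line `σ > σ₀` the clock has `ℓ > 0` with derivative `ℓ′` and `θ′ = ℓ⁻²`; `P > 0`; the profile
`W` is jointly `C¹` and `P`-periodic in `σ` with every slice `W(σ, ·) ≢ 0`, the similarity pressure
`Q` is `P`-periodic; at the clock times `θ(σ)` the physical fields are the modulated ansatz
`u(θ(σ), x) = ℓ(σ) • W(σ, ℓ(σ) • x)`, `p(θ(σ), x) = ℓ(σ)² Q(σ, ℓ(σ) • x)`, `t ↦ u(t, x)` is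
differentiable, and `∂ₜu + (u·∇)u + ∇p − νΔu = 0` (`ν : ℝ` arbitrary). The blow-up branch adds
bounded physical time, `θ(σ) → T` (hypothesis `hT` of each theorem). -/
variable (hP : 0 < P) (hℓ : ∀ σ, σ₀ < σ → HasDerivAt ℓ (ℓ' σ) σ) (hpos : ∀ σ, σ₀ < σ → 0 < ℓ σ)
  (hθ : ∀ σ, σ₀ < σ → HasDerivAt θ ((ℓ σ ^ 2)⁻¹) σ) (hW : ContDiff ℝ 1 (uncurry W))
  (hper : ∀ s, W (s + P) = W s) (hperQ : ∀ s, Q (s + P) = Q s)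
  (hW0 : ∀ σ, σ₀ < σ → W σ ≠ 0)
  (hans : ∀ σ, σ₀ < σ → ∀ x, u (θ σ) x = ℓ σ • W σ (ℓ σ • x))
  (hp : ∀ σ, σ₀ < σ → p (θ σ) = fun x => ℓ σ ^ 2 * Q σ (ℓ σ • x))
  (hu : ∀ σ, σ₀ < σ → ∀ x, DifferentiableAt ℝ (fun t => u t x) (θ σ))
  (heq : ∀ σ, σ₀ < σ → ∀ x : E,
    timeDeriv u (θ σ) x + convect (u (θ σ)) (u (θ σ)) x + gradient (p (θ σ)) x -
      ν • (Δ (u (θ σ))) x = 0)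

include hθ hpos in
/-- The clock's physical time is strictly increasing on every closed half-line `σ ≥ σ₁`, `σ₁ > σ₀`
(`θ′ = ℓ⁻² > 0`; `strictMonoOn_time`). [folklore] -/
theorem periodicProfile_strictMonoOn_time {σ₁ : ℝ} (hσ₁ : σ₀ < σ₁) : StrictMonoOn θ (Ici σ₁) :=
  strictMonoOn_time (fun s hs => hθ s (lt_of_lt_of_le hσ₁ hs))
    (fun s hs => (hpos s (lt_of_lt_of_le hσ₁ hs)).ne')

include hP hθ hpos in
/-- On the blow-up branch every clock time precedes the blow-up time: `θ(σ) < T` for `σ > σ₀`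
(`time_lt_blowupTime`). [folklore] -/
theorem periodicProfile_time_lt (hT : Tendsto θ atTop (𝓝 T)) {σ : ℝ} (hσ : σ₀ < σ) : θ σ < T :=
  time_lt_blowupTime hP (periodicProfile_strictMonoOn_time hpos hθ hσ) hT le_rfl

include hθ in
/-- Every physical time `t ∈ (θ(σ₁), T)`, `σ₁ > σ₀`, is a clock time `θ(σ)` with `σ > σ₁`
(`exists_clockTime_eq`). [folklore] -/
theorem periodicProfile_exists_clockTime (hT : Tendsto θ atTop (𝓝 T)) {σ₁ : ℝ} (hσ₁ : σ₀ < σ₁)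
    {t : ℝ} (ht : t ∈ Ioo (θ σ₁) T) : ∃ σ, σ₁ < σ ∧ θ σ = t :=
  exists_clockTime_eq (fun s hs => hθ s (lt_of_lt_of_le hσ₁ hs)) hT ht.1 ht.2

include hP hℓ hpos hθ hW hper hperQ hW0 hans hp hu heq

/-- **DSS AT EVERY PHYSICAL TIME OF A TERMINAL INTERVAL.** On the blow-up branch there is `c > 1`
such that, for every `σ₁ > σ₀`, the backward parabolic DSS covariance
`u(T − (T − t)/c², x) = c • u(t, c • x)` holds for EVERY physical time `t ∈ (θ(σ₁), T)` and every
`x` — not only at the clock times listed in `periodicProfile_blowup_rigidity` (those cover the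
interval, `periodicProfile_exists_clockTime`). [folklore] -/
theorem periodicProfile_dss_Ioo (hT : Tendsto θ atTop (𝓝 T)) :
    ∃ c : ℝ, 1 < c ∧ ∀ σ₁, σ₀ < σ₁ →
      ∀ t ∈ Ioo (θ σ₁) T, ∀ x : E, u (T - (T - t) / c ^ 2) x = c • u t (c • x) := by
  obtain ⟨c, hc, -, -, -, hcov, -⟩ :=
    periodicProfile_blowup_rigidity hP hℓ hpos hθ hW hper hperQ hW0 hans hp hu heq hT
  refine ⟨c, hc, fun σ₁ hσ₁ t ht x => ?_⟩
  obtain ⟨σ, hσ, rfl⟩ := periodicProfile_exists_clockTime hθ hT hσ₁ ht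
  exact hcov σ (hσ₁.trans hσ) x

/-- **In the tree's DSS vocabulary** (blow-up time normalised to `T = 0`): there is `c > 1` such
that for every `σ₁ > σ₀ + P` and EVERY physical time `t ∈ (θ(σ₁), 0)`, `nsRescale c u t = u t` —
the relation `IsDiscretelySelfSimilar c u` (`nsRescale c u = u`) restricted to a terminal time
interval (compare `periodicProfile_nsRescale_eq`, the same at the clock times). [folklore] -/
theorem periodicProfile_nsRescale_eq_Ioo (hT : Tendsto θ atTop (𝓝 0)) :
    ∃ c : ℝ, 1 < c ∧ ∀ σ₁, σ₀ + P < σ₁ → ∀ t ∈ Ioo (θ σ₁) 0, nsRescale c u t = u t := by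
  obtain ⟨c, hc, -, hfix, -, hcov, -⟩ :=
    periodicProfile_blowup_rigidity hP hℓ hpos hθ hW hper hperQ hW0 hans hp hu heq hT
  refine ⟨c, hc, fun σ₁ hσ₁ t ht => funext fun x => ?_⟩
  have hc2 : 0 < c ^ 2 := by positivity
  have hs : σ₀ < σ₁ - P := by linarith
  -- `θ σ₁ = θ (σ₁ − P)/c²`, so `c² t ∈ (θ(σ₁ − P), 0)` is a physical time of the covariance range
  have h1 : θ σ₁ = θ (σ₁ - P) / c ^ 2 := by
    have := hfix (σ₁ - P) hs
    rw [sub_add_cancel, zero_sub, zero_sub, neg_div, neg_inj] at this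
    exact this
  have ht' : c ^ 2 * t ∈ Ioo (θ (σ₁ - P)) 0 := by
    refine ⟨?_, by nlinarith [ht.2]⟩
    have := ht.1
    rw [h1, div_lt_iff₀ hc2] at this
    linarith
  obtain ⟨σ, hσ, hσt⟩ := periodicProfile_exists_clockTime hθ hT hs ht'
  have h2 := hcov σ (hs.trans hσ) x
  rw [zero_sub, zero_sub, neg_div, neg_neg, hσt, mul_div_cancel_left₀ _ hc2.ne'] at h2
  rw [nsRescale_apply, ← h2]

/-- **A bounded object has a vanishing slice — so there is none.** On the blow-up branch, if the
object is bounded on one backward parabolic cylinder at the blow-up point, `‖u‖ ≤ B` on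
`parabolicCylinder ρ (T, 0)`, then `u(t, ·) ≡ 0` for every physical time `t ∈ (θ(σ₁), T)`,
`σ₁ > σ₀` (`periodicProfile_dss_Ioo` + `eq_zero_of_dss_Ioo_of_norm_le`). [folklore] -/
theorem periodicProfile_eq_zero_of_norm_le (hT : Tendsto θ atTop (𝓝 T)) {ρ B : ℝ} (hρ : 0 < ρ)
    (hB : ∀ z ∈ parabolicCylinder ρ ((T, 0) : ℝ × E), ‖u z.1 z.2‖ ≤ B) {σ₁ : ℝ} (hσ₁ : σ₀ < σ₁) :
    ∀ t ∈ Ioo (θ σ₁) T, ∀ x : E, u t x = 0 := by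
  obtain ⟨c, hc, hcov⟩ := periodicProfile_dss_Ioo hP hℓ hpos hθ hW hper hperQ hW0 hans hp hu heq hT
  exact eq_zero_of_dss_Ioo_of_norm_le hc (hcov σ₁ hσ₁) hρ hB

/-- **THE BLOW-UP POINT IS GENUINELY SINGULAR.** On the blow-up branch the object is UNBOUNDED on
every backward parabolic cylinder at `(T, 0)`: for every `ρ > 0` and every `B` there is
`(t, x) ∈ parabolicCylinder ρ (T, 0)` with `‖u(t, x)‖ > B`. (Otherwise the slice at the clock time
`θ(σ₀ + 2) ∈ (θ(σ₀ + 1), T)` vanishes, `ℓ • W(σ₀ + 2, ℓ •) ≡ 0` with `ℓ > 0`, contradicting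
`W(σ₀ + 2, ·) ≢ 0`.) [folklore] -/
theorem periodicProfile_unbounded_near_blowupPoint (hT : Tendsto θ atTop (𝓝 T)) {ρ : ℝ}
    (hρ : 0 < ρ) (B : ℝ) :
    ∃ z ∈ parabolicCylinder ρ ((T, 0) : ℝ × E), B < ‖u z.1 z.2‖ := by
  by_contra h
  push Not at h
  have h1 : σ₀ < σ₀ + 1 := lt_add_one σ₀
  have h2 : σ₀ < σ₀ + 2 := by linarith
  have hzero := periodicProfile_eq_zero_of_norm_le hP hℓ hpos hθ hW hper hperQ hW0 hans hp hu heq hT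
    hρ h h1
  have hmem : θ (σ₀ + 2) ∈ Ioo (θ (σ₀ + 1)) T :=
    ⟨periodicProfile_strictMonoOn_time hpos hθ h1 (show σ₀ + 1 ∈ Ici (σ₀ + 1) from self_mem_Ici)
        (show σ₀ + 2 ∈ Ici (σ₀ + 1) by simp only [mem_Ici]; linarith) (by linarith),
      periodicProfile_time_lt hP hpos hθ hT h2⟩
  refine hW0 (σ₀ + 2) h2 (funext fun y => ?_)
  have hℓ2 := (hpos (σ₀ + 2) h2).ne'
  have hy := hzero _ hmem ((ℓ (σ₀ + 2))⁻¹ • y)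
  rw [hans _ h2, smul_smul, mul_inv_cancel₀ hℓ2, one_smul, smul_eq_zero] at hy
  exact hy.resolve_left hℓ2

end PeriodicProfile

end Summit.NavierStokesRegularity.FluidComputer.SelfSimilarCensus

end
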